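import Summits.CriticalPhenomena.CardyFormulaZ2.Theses.CardyBoundaryCoulombGas
import Literature.Analysis.SpecialFunctions.BesselJZeroFermiIntegral

/-!
# The paired Lorentzian kernel is positive semidefinite
(line `two-cluster-rate-is-stationary-gap`, crux `StripClusterRates`)

The scattering kernel `G'(x) = (√3/2)/(cosh 2x + 1/2)` of the ground-state Bethe equations of the
open staggered TL(1) chain at `γ = π/3` is a sum of PAIRED Lorentzians
`L_{a,b}(x) = a/(x² + a²) - b/(x² + b²)` with `0 < a ≤ b` (`bu_kernel_partialFraction`). This file
proves the registered helper `bu_lorentzPair_posSemidef` (H-d2 of the kernel-positivity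
infrastructure of the Bethe-asymptotics pillar BA₁): every such pair is a positive-semidefinite
kernel,

  `0 ≤ Σ_{j,l} L_{a,b}(p_j - p_l) y_j y_l`   for all `M`, `p y : Fin M → ℝ`.

## Proof (Bochner, by hand)

* `bu_lorentzPair_eq_integral`: the Laplace transform of the cosine,
  `∫₀^∞ e^{-cω} cos(xω) dω = c/(c² + x²)`
  (`Literature.Analysis.SpecialFunctions.integral_exp_neg_mul_cos`), gives
  `L_{a,b}(x) = ∫₀^∞ (e^{-aω} - e^{-bω}) cos(xω) dω`, the cosine transform of a weight which is
  NONNEGATIVE on `ω > 0` because `a ≤ b`.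
* `bu_sum_sum_mul_cos_sub_mul`:
  `Σ_{j,l} W cos((p_j - p_l)ω) y_j y_l = W [(Σ_j y_j cos(p_j ω))² + (Σ_j y_j sin(p_j ω))²]`
  (`cos(A - B) = cos A cos B + sin A sin B`).
* Commuting the finite double sum with the integral (`MeasureTheory.integral_finsetSum`), the
  quadratic form is `∫₀^∞ (e^{-aω} - e^{-bω}) [(Σ y cos)² + (Σ y sin)²] dω ≥ 0`
  (`MeasureTheory.setIntegral_nonneg`).
-/

noncomputable section

namespace Summit.CriticalPhenomena.CardyFormulaZ2.Cruxes.StripClusterRates.TwoClusterRateIsStationaryGap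

open MeasureTheory Set Filter

/-- `ω ↦ e^{-cω} cos(xω)` is integrable on `(0, ∞)` for `c > 0` (dominated by `e^{-cω}`).
[folklore] -/
theorem bu_integrableOn_exp_neg_mul_cos {c : ℝ} (hc : 0 < c) (x : ℝ) :
    IntegrableOn (fun ω : ℝ => Real.exp (-(c * ω)) * Real.cos (x * ω)) (Ioi 0) := by
  refine Integrable.mono' (exp_neg_integrableOn_Ioi 0 hc)
    (by fun_prop :
      Continuous fun ω : ℝ => Real.exp (-(c * ω)) * Real.cos (x * ω)).aestronglyMeasurable
    (Eventually.of_forall fun ω => ?_)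
  rw [Real.norm_eq_abs, abs_mul, Real.abs_exp, neg_mul]
  exact mul_le_of_le_one_right (Real.exp_pos _).le (Real.abs_cos_le_one _)

/-- `ω ↦ (e^{-aω} - e^{-bω}) cos(xω)` is integrable on `(0, ∞)` for `a, b > 0`. [folklore] -/
theorem bu_integrableOn_exp_sub_exp_mul_cos {a b : ℝ} (ha : 0 < a) (hb : 0 < b) (x : ℝ) :
    IntegrableOn (fun ω : ℝ => (Real.exp (-(a * ω)) - Real.exp (-(b * ω))) * Real.cos (x * ω))
      (Ioi 0) := by
  refine ((bu_integrableOn_exp_neg_mul_cos ha x).sub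
    (bu_integrableOn_exp_neg_mul_cos hb x)).congr (Eventually.of_forall fun ω => ?_)
  simp only [Pi.sub_apply]
  ring

/-- **A paired Lorentzian is the cosine transform of a sign-definite weight**: for `a, b > 0` and
real `x`, `a/(x² + a²) - b/(x² + b²) = ∫₀^∞ (e^{-aω} - e^{-bω}) cos(xω) dω` (the Laplace transform
of the cosine, `∫₀^∞ e^{-cω} cos(xω) dω = c/(c² + x²)`, applied twice). [folklore] -/
theorem bu_lorentzPair_eq_integral {a b : ℝ} (ha : 0 < a) (hb : 0 < b) (x : ℝ) :
    a / (x ^ 2 + a ^ 2) - b / (x ^ 2 + b ^ 2) =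
      ∫ ω in Ioi (0 : ℝ), (Real.exp (-(a * ω)) - Real.exp (-(b * ω))) * Real.cos (x * ω) := by
  rw [show x ^ 2 + a ^ 2 = a ^ 2 + x ^ 2 from add_comm _ _,
    show x ^ 2 + b ^ 2 = b ^ 2 + x ^ 2 from add_comm _ _,
    ← Literature.Analysis.SpecialFunctions.integral_exp_neg_mul_cos ha x,
    ← Literature.Analysis.SpecialFunctions.integral_exp_neg_mul_cos hb x,
    ← integral_sub (bu_integrableOn_exp_neg_mul_cos ha x)
      (bu_integrableOn_exp_neg_mul_cos hb x)]
  refine integral_congr_ae (Eventually.of_forall fun ω => ?_)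
  ring

/-- `Σ_{j,l} W cos((p_j - p_l)ω) y_j y_l = W [(Σ_j y_j cos(p_j ω))² + (Σ_j y_j sin(p_j ω))²]`: the
cosine kernel factorises (`cos(A - B) = cos A cos B + sin A sin B`), so a cosine transform of a
nonnegative weight is a positive-semidefinite kernel. [folklore] -/
theorem bu_sum_sum_mul_cos_sub_mul (W ω : ℝ) {M : ℕ} (p y : Fin M → ℝ) :
    ∑ j, ∑ l, W * Real.cos ((p j - p l) * ω) * y j * y l =
      W * ((∑ j, y j * Real.cos (p j * ω)) ^ 2 + (∑ j, y j * Real.sin (p j * ω)) ^ 2) := by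
  simp_rw [sq, Finset.sum_mul_sum, ← Finset.sum_add_distrib, Finset.mul_sum]
  refine Finset.sum_congr rfl fun j _ => Finset.sum_congr rfl fun l _ => ?_
  rw [sub_mul, Real.cos_sub]
  ring

/-- **H-d2 · a paired Lorentzian is a positive-semidefinite kernel.** For `0 < a ≤ b` the kernel
`L(x) = a/(x² + a²) - b/(x² + b²)` satisfies `Σ_{j,l} L(p_j - p_l) y_j y_l ≥ 0` for every finite
family of points `p` and real weights `y`: by `bu_lorentzPair_eq_integral` and
`bu_sum_sum_mul_cos_sub_mul` the quadratic form equals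
`∫₀^∞ (e^{-aω} - e^{-bω}) [(Σ_j y_j cos(p_j ω))² + (Σ_j y_j sin(p_j ω))²] dω`, whose integrand is
nonnegative on `ω > 0` since `a ≤ b` (Bochner's theorem for the Fourier pair
`L̂(ω) = π (e^{-a|ω|} - e^{-b|ω|}) ≥ 0`, proved by hand). [folklore] -/
theorem bu_lorentzPair_posSemidef : ∀ a b : ℝ, 0 < a → a ≤ b → ∀ (M : ℕ) (p y : Fin M → ℝ),
    0 ≤ ∑ j, ∑ l, (a / ((p j - p l) ^ 2 + a ^ 2) - b / ((p j - p l) ^ 2 + b ^ 2)) * y j * y l := by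
  intro a b ha hab M p y
  have hb : 0 < b := ha.trans_le hab
  -- every entry of the quadratic form is integrable against the weight
  have hI : ∀ j l : Fin M, IntegrableOn (fun ω : ℝ =>
      (Real.exp (-(a * ω)) - Real.exp (-(b * ω))) * Real.cos ((p j - p l) * ω) * y j * y l)
      (Ioi 0) := fun j l =>
    ((bu_integrableOn_exp_sub_exp_mul_cos ha hb (p j - p l)).mul_const _).mul_const _
  -- the quadratic form is the integral of the weighted cosine double sum
  have hkey :
      ∑ j, ∑ l, (a / ((p j - p l) ^ 2 + a ^ 2) - b / ((p j - p l) ^ 2 + b ^ 2)) * y j * y l =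
      ∫ ω in Ioi (0 : ℝ), ∑ j, ∑ l,
        (Real.exp (-(a * ω)) - Real.exp (-(b * ω))) * Real.cos ((p j - p l) * ω) * y j * y l := by
    rw [integral_finsetSum Finset.univ fun j _ =>
      integrable_finsetSum Finset.univ fun l _ => hI j l]
    refine Finset.sum_congr rfl fun j _ => ?_
    rw [integral_finsetSum Finset.univ fun l _ => hI j l]
    refine Finset.sum_congr rfl fun l _ => ?_
    rw [bu_lorentzPair_eq_integral ha hb, integral_mul_const, integral_mul_const]
  rw [hkey]
  refine setIntegral_nonneg measurableSet_Ioi fun ω hω => ?_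
  -- pointwise: nonnegative weight times a sum of two squares
  have hW : 0 ≤ Real.exp (-(a * ω)) - Real.exp (-(b * ω)) :=
    sub_nonneg.2 (Real.exp_le_exp.2 (neg_le_neg
      (mul_le_mul_of_nonneg_right hab (le_of_lt (mem_Ioi.1 hω)))))
  show 0 ≤ ∑ j, ∑ l,
    (Real.exp (-(a * ω)) - Real.exp (-(b * ω))) * Real.cos ((p j - p l) * ω) * y j * y l
  rw [bu_sum_sum_mul_cos_sub_mul]
  exact mul_nonneg hW (by positivity)

end Summit.CriticalPhenomena.CardyFormulaZ2.Cruxes.StripClusterRates.TwoClusterRateIsStationaryGap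

end
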